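import Mathlib
import Summits.Ventures.PercRepro2.TypedA3Inactive
import Summits.Ventures.PercRepro2.TypedRow23

/-!
# (ROW-23) with an inactive `a₃` from the two-copy cross counts (blind cell PercRepro2, night-3
g19, 2026-08-28; `proofs/NIGHT3-CERT.md` §28.7)

The mechanism of (ROW-23), `N(g := 2) ≥ N(g := 3)`, on the instances with an inactive `a₃`:
by the spectator decomposition (`typedCount_eq_of_inactive`, g3) the typed count is a sum over
the first copy `x` of `1_Q(x)` times two-copy cross counts on the minor `(G_x, z_x)` of `x`.
Along a typed edge `g` of type `2`:

* a spectator `x` WITHOUT `g` sees `g` pinned open in its pair — the same pair count as the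
  spectator `x[g := open]` of the contracted instance, but weighted by `1_Q(x) ≥ 1_Q(x[g := open])`
  (`Q = {a₁ ↮ a₂}` is decreasing);
* a spectator `x` WITH `g` sees `g` complementary in its pair — a cross count, nonnegative.

So `N(g := 2) − N(g := 3) = Σ_x [1_Q(x) − 1_Q(x[g := open])] · PC_x + Σ_x 1_Q(x) · PC′_x ≥ 0` given
the two-copy statement `CrossCount` (row (BASE) / 2′TBHK of the cell) in both orientations —
`row23_of_inactive`. The statement is conditional on `CrossCount` exactly as g3's
`TypedBases_of_inactive`; the general (ROW-23) stays a candidate (`Row23`). Own work; standard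
axioms.
-/

namespace Summit.Ventures.PercRepro2

open UnionCluster

namespace CovForm

namespace Row23Red

open TypedA3 TypedRed

section Main

open Classical

variable {V : Type*} {E : Type*} [Fintype E] [DecidableEq E] [DecidableEq V] {R : Type*}
  [Field R] [LinearOrder R] [IsStrictOrderedRing R]

omit [Fintype E] [DecidableEq V] in
/-- Opening an edge only increases the configuration. -/
lemma le_update_true' (x : Config E) (g : E) : x ≤ Function.update x g true := by
  intro e
  by_cases he : e = g
  · subst he; simp
  · rw [Function.update_of_ne he]

omit [Fintype E] [DecidableEq V] in
/-- `1_Q` is decreasing: opening an edge cannot create the avoidance `a₂ ↮ a₁`. -/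
lemma iQ_update_true_le (ends : E → Sym2 V) (a₁ a₂ : V) (x : Config E) (g : E) :
    (iQ ends a₁ a₂ (Function.update x g true) : R) ≤ iQ ends a₁ a₂ x := by
  unfold iQ
  simp only [Set.indicator_apply, mem_avoidAll, Finset.mem_singleton, forall_eq, Pi.one_apply]
  by_cases h : Conn ends x a₂ a₁
  · have h' : Conn ends (Function.update x g true) a₂ a₁ := conn_mono (le_update_true' x g) h
    simp [h, h']
  · by_cases h' : Conn ends (Function.update x g true) a₂ a₁ <;> simp [h, h']

omit [Fintype E] [DecidableEq V] [LinearOrder R] [IsStrictOrderedRing R] in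
/-- The spectator's free set is unchanged by moving a closed type-`2` edge `g` out of `F` and
opening it in the spectator. -/
lemma specFree_erase_update (F : Finset E) (τ : E → ℕ) (x : Config E) (g : E) (hg : g ∈ F)
    (hτg : τ g = 2) (hx : x g = false) :
    specFree F τ x = specFree (F.erase g) τ (Function.update x g true) := by
  ext e
  simp only [mem_specFree, Finset.mem_erase]
  by_cases he : e = g
  · subst he; simp [hτg, hx]
  · rw [Function.update_of_ne he]; tauto

omit [Fintype E] [DecidableEq V] [LinearOrder R] [IsStrictOrderedRing R] in
/-- The spectator's pinning is unchanged too: `g` is pinned open in both. -/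
lemma specPin_erase_update (F : Finset E) (z : Config E) (τ : E → ℕ) (x : Config E) (g : E)
    (hg : g ∈ F) (hτg : τ g = 2) (hx : x g = false) :
    specPin F z τ x = specPin (F.erase g) (Function.update z g true) τ (Function.update x g true) := by
  funext e
  unfold specPin
  by_cases he : e = g
  · subst he; simp [hg, hτg, hx]
  · rw [Function.update_of_ne he, Function.update_of_ne he]
    simp [Finset.mem_erase, he]

omit [Fintype E] [DecidableEq V] [LinearOrder R] [IsStrictOrderedRing R] in
/-- The spectator condition of the contracted instance for `x[g := open]` is the spectator
condition of the instance for `x`. -/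
lemma spec_cond_erase_update (F : Finset E) (z : Config E) (x : Config E) (g : E) (hg : g ∈ F) :
    (∀ e, e ∉ F.erase g → Function.update x g true e = Function.update z g true e) ↔
      (∀ e, e ∉ F → x e = z e) := by
  constructor
  · intro h e he
    have hne : e ≠ g := fun h' => he (h' ▸ hg)
    have := h e (fun h' => he (Finset.mem_of_mem_erase h'))
    rwa [Function.update_of_ne hne, Function.update_of_ne hne] at this
  · intro h e he
    by_cases hne : e = g
    · subst hne; simp
    · rw [Function.update_of_ne hne, Function.update_of_ne hne]
      exact h e (fun h' => he (Finset.mem_erase.2 ⟨hne, h'⟩))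

omit [DecidableEq V] [LinearOrder R] [IsStrictOrderedRing R] in
/-- Summing over configurations with `g` open is summing over those with `g` closed after the
flip of `g`. -/
lemma sum_flip (g : E) (B : Config E → R) :
    (∑ x : Config E, if x g = true then B x else 0) =
      ∑ x : Config E, if x g = false then B (Function.update x g true) else 0 := by
  let σ : Equiv.Perm (Config E) :=
    Function.Involutive.toPerm (fun x => Function.update x g (!x g)) (by
      intro x; funext e
      by_cases he : e = g
      · subst he; simp
      · simp [Function.update_of_ne he])
  rw [← Equiv.sum_comp σ (fun x => if x g = true then B x else 0)]
  refine Finset.sum_congr rfl fun x _ => ?_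
  simp only [σ, Function.Involutive.coe_toPerm, Function.update_self]
  cases hx : x g
  · simp
  · simp

omit [DecidableEq V] in
/-- **(ROW-23) with an inactive `a₃`, from the two-copy cross counts**: for `g ∈ F` of type `2`,
`N(g := 3) ≤ N(g := 2)`. -/
theorem row23_of_inactive {ends : E → Sym2 V} {o a₁ a₂ a₃ b : V}
    (hin : ∀ ω : Config E, ¬ Conn ends ω a₁ a₃ ∧ ¬ Conn ends ω a₂ a₃)
    (hob : CrossCount R ends a₁ a₂ o b) (hbo : CrossCount R ends a₁ a₂ b o)
    (F : Finset E) (z : Config E) (τ : E → ℕ) (hτ : ∀ e ∈ F, τ e = 1 ∨ τ e = 2) (g : E)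
    (hg : g ∈ F) (hτg : τ g = 2) :
    typedCount F z (Function.update τ g 3)
        (K3 ends o a₁ a₂ a₃ b : Config E → Config E → Config E → R) ≤
      typedCount F z τ (K3 ends o a₁ a₂ a₃ b) := by
  have hτ' : ∀ e ∈ F.erase g, τ e = 1 ∨ τ e = 2 := fun e he => hτ e (Finset.mem_of_mem_erase he)
  rw [typedCount_update_three F g hg z τ, typedCount_eq_of_inactive hin F z τ hτ,
    typedCount_eq_of_inactive hin (F.erase g) (Function.update z g true) τ hτ']
  -- the pair count of a spectator `x`
  set PC : Finset E → Config E → R := fun G zx =>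
    pinnedCount G zx (crossKernel (R := R) ends a₁ a₂ b o) +
      pinnedCount G zx (crossKernel (R := R) ends a₁ a₂ o b) with hPC
  have hPCnn : ∀ G zx, 0 ≤ PC G zx := fun G zx => add_nonneg (hbo G zx) (hob G zx)
  set B : Config E → R := fun x =>
    if (∀ e, e ∉ F.erase g → x e = Function.update z g true e) then
      iQ ends a₁ a₂ x * PC (specFree (F.erase g) τ x)
        (specPin (F.erase g) (Function.update z g true) τ x) else 0 with hB
  set A : Config E → R := fun x =>
    if (∀ e, e ∉ F → x e = z e) then
      iQ ends a₁ a₂ x * PC (specFree F τ x) (specPin F z τ x) else 0 with hA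
  change ∑ x, B x ≤ ∑ x, A x
  -- `B` vanishes on the spectators without `g`
  have hB0 : ∀ x : Config E, x g = false → B x = 0 := by
    intro x hx
    simp only [hB]
    rw [if_neg]
    intro h
    have := h g (Finset.notMem_erase g F)
    rw [hx, Function.update_self] at this
    exact Bool.false_ne_true this
  have hBsum : (∑ x : Config E, B x) = ∑ x : Config E, if x g = true then B x else 0 := by
    refine Finset.sum_congr rfl fun x _ => ?_
    cases hx : x g
    · simp [hB0 x hx]
    · simp
  rw [hBsum, sum_flip g B]
  refine Finset.sum_le_sum fun x _ => ?_
  cases hx : x g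
  · -- spectator without `g`: the contracted spectator is `x[g := open]`
    simp only [if_true]
    simp only [hA, hB]
    by_cases hc : ∀ e, e ∉ F → x e = z e
    · rw [if_pos hc, if_pos ((spec_cond_erase_update F z x g hg).2 hc),
        ← specFree_erase_update F τ x g hg hτg hx, ← specPin_erase_update F z τ x g hg hτg hx]
      exact mul_le_mul_of_nonneg_right (iQ_update_true_le ends a₁ a₂ x g) (hPCnn _ _)
    · rw [if_neg hc, if_neg (fun h => hc ((spec_cond_erase_update F z x g hg).1 h))]
  · -- spectator with `g`: a nonnegative cross count
    simp only [Bool.true_eq_false, if_false, hA]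
    split_ifs
    · exact mul_nonneg (iQ_nonneg ends a₁ a₂ x) (hPCnn _ _)
    · exact le_rfl

end Main

end Row23Red

end CovForm

end Summit.Ventures.PercRepro2
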